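import Literature.NumberTheory.LFunctions.FordProgram1
import HarnessLib

/-!
# Ford's "Program 1": kernel run 09 (`535 ≤ k ≤ 564`)

Topic `Literature/NumberTheory/LFunctions`. Everything here is PROVED (one kernel evaluation, standard
axioms): `FordP1.checkT k = true` for `535 ≤ k ≤ 564`, i.e. the certified re-run of PROGRAM 1 of
K. Ford, Proc. LMS 85 (2002) (the second part of Theorem 3) for these `k` — see `FordProgram1.lean`
for the checker, its soundness `FordP1.row_of_checkK`, and the meaning of the constants
(`ρ = FordP1.rhoOf k / 10⁵`, `θ = FordP1.thetaOf k / 10⁴`, `ω = FordP1.omOf k / 10⁴`). The runs are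
split into files of comparable kernel time (a few minutes each; `maxHeartbeats 0` lifts the
deterministic time-out for the one declaration); the assembly is `FordTheorem3SmallK.lean`.

## References

* K. Ford, Proc. London Math. Soc. (3) 85 (2002), 565–633; arXiv:1910.08209: Theorem 3, (1.7),
  Lemmas 3.4–3.5, Appendix "PROGRAM 1". [Ford2002]
-/

namespace Literature.NumberTheory.LFunctions
namespace FordP1

set_option maxHeartbeats 0 in
/-- **Kernel run 09**: `checkT k` for `535 ≤ k ≤ 564`. [cite: Ford2002, Theorem 3 (second part)
and PROGRAM 1] -/
theorem run09 : ((List.range' 535 30).all checkT) = true := by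
  decide +kernel

end FordP1
end Literature.NumberTheory.LFunctions
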